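import Mathlib
import Literature.MathematicalPhysics.QuantumFieldTheory.OSReconstructionNoE1Proofs
import Literature.MathematicalPhysics.QuantumFieldTheory.OSJointSpectralMeasureUniqueness
import HarnessLib

/-!
# `stub_linearity` — null sets of joint spectral measures pass to the closed linear span

Crux `MirrorModularBoosts.PlanarSpectralCone` (stmt-QuantumFields-9664), line
`positivity-disc-to-operator-cone`, stub 4.

**What.** For ANY labelled Schwinger family with E2 and translation invariance on `⁰𝒮`
(`OSReconstructionNoE1`, any labels, any dimension `d ≥ 1`): a set `N` of energy–momentum space that
is null for every joint spectral measure of every vector of a set `D` of dense linear span is null for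
every joint spectral measure of every vector.

**Why it is needed.** Cone support `μ_ψ {p₀ < |p₁|} = 0` is obtained (stubs 1–3 of the line) only for
the cone-chain field vectors, which merely SPAN a dense subspace; this stub moves it to all of
`h.Hilbert`, i.e. to the operator cone `H ≥ |P₁|` (the Transfer `C⁺` of the crux card).

**Route** (PVM-free; Part D of the drefute gen-4 candidate `Cruxes/PlanarSpectralCone/DrefuteG4Linearity.lean`,
whose Parts A–C — Laplace–Fourier uniqueness on `{p₀ ≥ 0}` and the quadratic-form calculus of
`ψ ↦ μ_ψ` as measures — are now the tree file
`Literature/MathematicalPhysics/QuantumFieldTheory/OSJointSpectralMeasureUniqueness.lean`):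
with the canonical measures `μ_φ = h.jointSpectralMeasure φ` (joint spectral measures by the tree theorem
`exists_isJointSpectralMeasure_holds`), `V = {φ | μ_φ N = 0}` is a submodule by the parallelogram law
`μ_{φ₁+φ₂} + μ_{φ₁−φ₂} = 2(μ_{φ₁} + μ_{φ₂})` (`IsJointSpectralMeasure.add_parallelogram`, giving
`μ_{φ₁+φ₂} N ≤ 2(μ_{φ₁} N + μ_{φ₂} N)`) and the scaling law `μ_{cφ} = |c|² μ_φ`
(`IsJointSpectralMeasure.eq_smul`); it is closed since `μ_φ N ≤ 2 μ_θ N + 2 μ_{φ−θ}(ℝ^d) = 2 μ_θ N + 2‖φ − θ‖²`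
(`IsJointSpectralMeasure.measure_univ`); it contains `D`, hence `closure (span D) = ⊤`; finally
uniqueness (`IsJointSpectralMeasure.unique`) moves the conclusion from `μ_ψ` to the given `μ`.
The measurability hypothesis `hN` is not needed (kept for the registered signature).
-/

noncomputable section

namespace Summit.QuantumFields.YangMills.Cruxes.PlanarSpectralCone.PositivityDiscToOperatorCone

open MeasureTheory
open scoped InnerProductSpace SchwartzMap
open Literature.MathematicalPhysics.QuantumLattice Literature.MathematicalPhysics.AQFT
  Literature.MathematicalPhysics.QuantumFieldTheory
open Set
open scoped NNReal ENNReal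

-- Part D ported from Cruxes/PlanarSpectralCone/DrefuteG4Linearity.lean (namespace `DrefuteG4`)

/-- **CLOSURE / LINEARITY — null sets of joint spectral measures pass to the closed span.** For ANY
labelled family with E2 and translation invariance on `⁰𝒮` (any labels, any dimension), a Borel set `N` of
energy–momentum space that is null for every joint spectral measure of every vector of a set `D` of dense
linear span is null for every joint spectral measure of every vector. (The measurability hypothesis
`hN` is not needed: `V = {φ | μ_φ N = 0}` is a closed submodule containing `D` for ANY set `N`, by the
parallelogram and scaling laws of the — unique — joint spectral measures.) -/
theorem stub_linearity {ι : Type*} {d : ℕ} [NeZero d]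
    {S : LabelledSchwingerFamily ι (EuclideanSpace ℝ (Fin d))} (h : OSReconstructionNoE1 S)
    {N : Set (EuclideanSpace ℝ (Fin d))} (hN : MeasurableSet N) {D : Set h.Hilbert}
    (hD : Dense ((Submodule.span ℂ D : Submodule ℂ h.Hilbert) : Set h.Hilbert))
    (hDN : ∀ ψ ∈ D, ∀ μ : Measure (EuclideanSpace ℝ (Fin d)), h.IsJointSpectralMeasure ψ μ → μ N = 0)
    (ψ : h.Hilbert) (μ : Measure (EuclideanSpace ℝ (Fin d))) (hμ : h.IsJointSpectralMeasure ψ μ) :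
    μ N = 0 := by
  have _ := hN -- measurability of `N` is not needed (referenced only to keep the registered signature)
  classical
  -- canonical joint spectral measures (existence is the tree theorem `exists_isJointSpectralMeasure_holds`)
  set μv : h.Hilbert → Measure (EuclideanSpace ℝ (Fin d)) := fun φ => h.jointSpectralMeasure φ with hμv_def
  have hμv : ∀ φ : h.Hilbert, h.IsJointSpectralMeasure φ (μv φ) := fun φ =>
    h.isJointSpectralMeasure_jointSpectralMeasure
      (OSReconstructionNoE1.exists_isJointSpectralMeasure_holds h φ)
  -- parallelogram inequality, scaling, zero
  have hpar : ∀ φ₁ φ₂ : h.Hilbert, μv (φ₁ + φ₂) N ≤ 2 * (μv φ₁ N + μv φ₂ N) := by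
    intro φ₁ φ₂
    have e := (hμv (φ₁ + φ₂)).add_parallelogram (hμv (φ₁ - φ₂)) (hμv φ₁) (hμv φ₂)
    calc μv (φ₁ + φ₂) N ≤ (μv (φ₁ + φ₂) + μv (φ₁ - φ₂)) N := by
          rw [Measure.add_apply]; exact le_self_add
      _ = ((2 : ℝ≥0) • (μv φ₁ + μv φ₂)) N := by rw [e]
      _ = 2 * (μv φ₁ N + μv φ₂ N) := by
          rw [Measure.smul_apply, Measure.add_apply, ENNReal.smul_def, smul_eq_mul]
          norm_num
  have hsmul : ∀ (c : ℂ) (φ : h.Hilbert), μv (c • φ) N = (‖c‖₊ ^ 2 : ℝ≥0) • μv φ N := by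
    intro c φ
    have e := (hμv (c • φ)).eq_smul c (hμv φ)
    rw [e, Measure.smul_apply]
  have hzero : μv 0 N = 0 := by
    have e := hsmul 0 0
    rw [smul_zero] at e
    rw [e]
    simp
  -- the subspace `V = {φ | μ_φ N = 0}`
  let V : Submodule ℂ h.Hilbert :=
    { carrier := {φ | μv φ N = 0}
      add_mem' := fun {φ₁ φ₂} h₁ h₂ => by
        simp only [Set.mem_setOf_eq] at h₁ h₂ ⊢
        refine le_antisymm ?_ bot_le
        calc μv (φ₁ + φ₂) N ≤ 2 * (μv φ₁ N + μv φ₂ N) := hpar φ₁ φ₂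
          _ = 0 := by rw [h₁, h₂]; simp
      zero_mem' := hzero
      smul_mem' := fun c φ hφ => by
        simp only [Set.mem_setOf_eq] at hφ ⊢
        rw [hsmul, hφ, smul_zero] }
  -- `V` is closed: `μ_φ N ≤ 2 μ_θ N + 2 μ_{φ−θ} N ≤ 2‖φ − θ‖²` for `θ ∈ V` close to `φ`
  have hVc : IsClosed (V : Set h.Hilbert) := by
    refine isClosed_of_closure_subset fun φ hφ => ?_
    show μv φ N = 0
    refine le_antisymm (ENNReal.le_of_forall_pos_le_add fun ε hε _ => ?_) bot_le
    rw [zero_add]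
    have hδ : (0 : ℝ) < min 1 ((ε : ℝ) / 2) := by
      have : (0 : ℝ) < ε := by exact_mod_cast hε
      positivity
    obtain ⟨θ, hθV, hθ⟩ := Metric.mem_closure_iff.1 hφ (min 1 ((ε : ℝ) / 2)) hδ
    have hθ0 : μv θ N = 0 := hθV
    rw [dist_eq_norm] at hθ
    have hr : 2 * ‖φ - θ‖ ^ 2 ≤ (ε : ℝ) := by
      have h1 : ‖φ - θ‖ < 1 := lt_of_lt_of_le hθ (min_le_left _ _)
      have h2 : ‖φ - θ‖ < (ε : ℝ) / 2 := lt_of_lt_of_le hθ (min_le_right _ _)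
      have h0 : 0 ≤ ‖φ - θ‖ := norm_nonneg _
      nlinarith
    calc μv φ N = μv (θ + (φ - θ)) N := by rw [add_sub_cancel]
      _ ≤ 2 * (μv θ N + μv (φ - θ) N) := hpar θ (φ - θ)
      _ = 2 * μv (φ - θ) N := by rw [hθ0, zero_add]
      _ ≤ 2 * μv (φ - θ) univ := by gcongr; exact subset_univ _
      _ = 2 * ENNReal.ofReal (‖φ - θ‖ ^ 2) := by rw [(hμv _).measure_univ]
      _ = ENNReal.ofReal (2 * ‖φ - θ‖ ^ 2) := by
          rw [ENNReal.ofReal_mul (by norm_num : (0 : ℝ) ≤ 2)]; norm_num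
      _ ≤ ENNReal.ofReal (ε : ℝ) := ENNReal.ofReal_le_ofReal hr
      _ = ε := ENNReal.ofReal_coe_nnreal
  -- `D ⊆ V`, hence `closure (span D) ⊆ V`, hence `ψ ∈ V`
  have hDV : D ⊆ (V : Set h.Hilbert) := fun φ hφ => hDN φ hφ (μv φ) (hμv φ)
  have hspan : ((Submodule.span ℂ D : Submodule ℂ h.Hilbert) : Set h.Hilbert) ⊆ V :=
    Submodule.span_le.2 hDV
  have hcl : closure ((Submodule.span ℂ D : Submodule ℂ h.Hilbert) : Set h.Hilbert) ⊆ V :=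
    closure_minimal hspan hVc
  have hψV : μv ψ N = 0 := hcl (hD ψ)
  rwa [hμ.unique (hμv ψ)]

end Summit.QuantumFields.YangMills.Cruxes.PlanarSpectralCone.PositivityDiscToOperatorCone
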